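import Mathlib

/-!
# Crux `ExactCertificate` (stmt-AtomisticToContinuum-11959), line `closure-makes-nogap-exact`,
# skeleton VIII (`InvisibilityDichotomy`): stub `stub_sliceEntire`

Support file for the crux `ThreeConeCertificate.ExactCertificate`, skeleton VIII
(`Cruxes.ExactCertificate.Invisibility.InvisibilityDichotomy`: no nonzero finite-range continuous
radial kernel on `ℝ³` has Fourier transform vanishing on a lattice minus the origin).  The engine of
that skeleton applies Jensen's inequality to an ENTIRE function of exponential type whose
restriction to `ℝ` is the slice `s ↦ 𝓕 A (s • e₀)` of the Fourier transform of the compactly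
supported kernel `A` along the first axis `e₀ = EuclideanSpace.single 0 1`.  This file supplies
that extension (the easy half of Paley–Wiener), for an integrable `A : ℝ³ → ℂ` vanishing outside
the ball of radius `L`:

  `Φ z := ∫ v, exp (-2π i z v₀) A v`,   `v₀ := v 0` the first coordinate.

* `Φ` is entire: differentiation under the integral sign
  (`hasDerivAt_integral_of_dominated_loc_of_deriv_le` on the ball `B(z₀, 1)`, the `z`-derivative
  being dominated by `2π L' e^{2π L' (‖z₀‖ + 1)} ‖A v‖` with `L' := max L 1`);
* `‖Φ z‖ ≤ ‖A‖₁ e^{2π L' ‖z‖}`, because `‖exp (-2π i z v₀)‖ ≤ e^{2π |v₀| ‖z‖}` and `A v = 0`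
  unless `|v₀| ≤ ‖v‖ ≤ L ≤ L'`;
* `Φ s = 𝓕 A (s • e₀)` for real `s`, because `⟪v, s • e₀⟫ = s v₀` (`Real.fourier_eq'`,
  `EuclideanSpace.inner_single_right`).

Pure Mathlib (`Complex.norm_exp`, `Complex.re_le_norm`, `PiLp.norm_apply_le`,
`MeasureTheory.Integrable.mono'`, `norm_integral_le_integral_norm`, `integral_mono`); private
helper lemmas only, no named facts.  All `[folklore]`.
-/

noncomputable section

namespace Summit.AtomisticToContinuum.Crystallization.Theorems.ThreeConeCertificateExactCertificate.Invisibility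

open MeasureTheory
open scoped FourierTransform RealInnerProductSpace Real

/-- `‖exp (a z i)‖ ≤ e^{L' ‖z‖}` for a real coefficient `a` with `|a| ≤ L'`
(`‖exp w‖ = e^{re w} ≤ e^{‖w‖}` and `‖a z i‖ = |a| ‖z‖`). [folklore] -/
private theorem norm_cexp_ofReal_mul_mul_I_le {a L' : ℝ} (ha : |a| ≤ L') (z : ℂ) :
    ‖Complex.exp ((a : ℂ) * z * Complex.I)‖ ≤ Real.exp (L' * ‖z‖) := by
  rw [Complex.norm_exp]
  refine Real.exp_le_exp.2 ((Complex.re_le_norm _).trans ?_)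
  rw [norm_mul, norm_mul, Complex.norm_real, Complex.norm_I, mul_one, Real.norm_eq_abs]
  exact mul_le_mul_of_nonneg_right ha (norm_nonneg _)

/-- The phase coefficient is controlled by the radius: `|-2π v₀| ≤ 2π L'` whenever `‖v‖ ≤ L'`
(`|v₀| ≤ ‖v‖`, `PiLp.norm_apply_le`). [folklore] -/
private theorem abs_coeff_le {v : EuclideanSpace ℝ (Fin 3)} {L' : ℝ} (hv : ‖v‖ ≤ L') :
    |(-2 * π * v 0)| ≤ 2 * π * L' := by
  have h0 : |v 0| ≤ ‖v‖ := by simpa [Real.norm_eq_abs] using PiLp.norm_apply_le v 0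
  calc |(-2 * π * v 0)| = 2 * π * |v 0| := by
        rw [abs_mul, abs_mul, abs_neg, abs_two, abs_of_pos Real.pi_pos]
    _ ≤ 2 * π * L' := by
        gcongr
        exact h0.trans hv

/-- Pointwise bound on the slice integrand: `‖exp (-2π i z v₀) A v‖ ≤ e^{2π L' ‖z‖} ‖A v‖` with
`L' = max L 1`, using `A v = 0` off the ball of radius `L`. [folklore] -/
private theorem norm_integrand_le {A : EuclideanSpace ℝ (Fin 3) → ℂ} {L : ℝ}
    (hsupp : ∀ v : EuclideanSpace ℝ (Fin 3), L < ‖v‖ → A v = 0) (z : ℂ)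
    (v : EuclideanSpace ℝ (Fin 3)) :
    ‖Complex.exp (((-2 * π * v 0 : ℝ) : ℂ) * z * Complex.I) * A v‖ ≤
      Real.exp (2 * π * max L 1 * ‖z‖) * ‖A v‖ := by
  by_cases hv : L < ‖v‖
  · simp [hsupp v hv]
  · rw [norm_mul]
    have hvL : ‖v‖ ≤ max L 1 := (le_of_not_gt hv).trans (le_max_left _ _)
    exact mul_le_mul_of_nonneg_right (norm_cexp_ofReal_mul_mul_I_le (abs_coeff_le hvL) z)
      (norm_nonneg _)

/-- Pointwise bound on the `z`-derivative of the slice integrand: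
`‖exp (-2π i z v₀) (-2π i v₀) A v‖ ≤ 2π L' e^{2π L' ‖z‖} ‖A v‖`, `L' = max L 1`. [folklore] -/
private theorem norm_integrand_deriv_le {A : EuclideanSpace ℝ (Fin 3) → ℂ} {L : ℝ}
    (hsupp : ∀ v : EuclideanSpace ℝ (Fin 3), L < ‖v‖ → A v = 0) (z : ℂ)
    (v : EuclideanSpace ℝ (Fin 3)) :
    ‖Complex.exp (((-2 * π * v 0 : ℝ) : ℂ) * z * Complex.I) *
        (((-2 * π * v 0 : ℝ) : ℂ) * Complex.I) * A v‖ ≤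
      2 * π * max L 1 * Real.exp (2 * π * max L 1 * ‖z‖) * ‖A v‖ := by
  by_cases hv : L < ‖v‖
  · simp [hsupp v hv]
  · have hvL : ‖v‖ ≤ max L 1 := (le_of_not_gt hv).trans (le_max_left _ _)
    have hc := abs_coeff_le hvL
    rw [norm_mul, norm_mul]
    refine mul_le_mul_of_nonneg_right ?_ (norm_nonneg _)
    rw [mul_comm]
    refine mul_le_mul ?_ (norm_cexp_ofReal_mul_mul_I_le hc z) (norm_nonneg _) (by positivity)
    rw [norm_mul, Complex.norm_real, Complex.norm_I, mul_one, Real.norm_eq_abs]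
    exact hc

/-- The slice integrand `v ↦ exp (-2π i z v₀) A v` is a.e.-strongly measurable (continuous phase
times the integrable `A`). [folklore] -/
private theorem aestronglyMeasurable_integrand {A : EuclideanSpace ℝ (Fin 3) → ℂ}
    (hA : Integrable A) (z : ℂ) :
    AEStronglyMeasurable (fun v : EuclideanSpace ℝ (Fin 3) =>
      Complex.exp (((-2 * π * v 0 : ℝ) : ℂ) * z * Complex.I) * A v) volume := by
  have hc : Continuous fun v : EuclideanSpace ℝ (Fin 3) =>
      Complex.exp (((-2 * π * v 0 : ℝ) : ℂ) * z * Complex.I) := by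
    fun_prop
  exact hc.aestronglyMeasurable.mul hA.aestronglyMeasurable

/-- The `z`-derivative `v ↦ exp (-2π i z v₀) (-2π i v₀) A v` of the slice integrand is
a.e.-strongly measurable. [folklore] -/
private theorem aestronglyMeasurable_integrand_deriv {A : EuclideanSpace ℝ (Fin 3) → ℂ}
    (hA : Integrable A) (z : ℂ) :
    AEStronglyMeasurable (fun v : EuclideanSpace ℝ (Fin 3) =>
      Complex.exp (((-2 * π * v 0 : ℝ) : ℂ) * z * Complex.I) *
        (((-2 * π * v 0 : ℝ) : ℂ) * Complex.I) * A v) volume := by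
  have hc : Continuous fun v : EuclideanSpace ℝ (Fin 3) =>
      Complex.exp (((-2 * π * v 0 : ℝ) : ℂ) * z * Complex.I) *
        (((-2 * π * v 0 : ℝ) : ℂ) * Complex.I) := by
    fun_prop
  exact hc.aestronglyMeasurable.mul hA.aestronglyMeasurable

/-- The slice integrand is integrable for every `z` (dominated by `e^{2π L' ‖z‖} ‖A v‖`).
[folklore] -/
private theorem integrable_integrand {A : EuclideanSpace ℝ (Fin 3) → ℂ} {L : ℝ}
    (hA : Integrable A) (hsupp : ∀ v : EuclideanSpace ℝ (Fin 3), L < ‖v‖ → A v = 0) (z : ℂ) :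
    Integrable (fun v : EuclideanSpace ℝ (Fin 3) =>
      Complex.exp (((-2 * π * v 0 : ℝ) : ℂ) * z * Complex.I) * A v) :=
  Integrable.mono' (hA.norm.const_mul (Real.exp (2 * π * max L 1 * ‖z‖)))
    (aestronglyMeasurable_integrand hA z) (ae_of_all _ fun v => norm_integrand_le hsupp z v)

/-- Differentiation under the integral sign: the slice integral `z ↦ ∫ exp (-2π i z v₀) A v dv`
is complex-differentiable at every `z₀`, with derivative the integral of the `z`-derivative of
the integrand (`hasDerivAt_integral_of_dominated_loc_of_deriv_le` on the ball `B(z₀, 1)`).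
[folklore] -/
private theorem hasDerivAt_sliceIntegral {A : EuclideanSpace ℝ (Fin 3) → ℂ} {L : ℝ}
    (hA : Integrable A) (hsupp : ∀ v : EuclideanSpace ℝ (Fin 3), L < ‖v‖ → A v = 0) (z₀ : ℂ) :
    HasDerivAt (fun z : ℂ => ∫ v : EuclideanSpace ℝ (Fin 3),
        Complex.exp (((-2 * π * v 0 : ℝ) : ℂ) * z * Complex.I) * A v)
      (∫ v : EuclideanSpace ℝ (Fin 3),
        Complex.exp (((-2 * π * v 0 : ℝ) : ℂ) * z₀ * Complex.I) *
          (((-2 * π * v 0 : ℝ) : ℂ) * Complex.I) * A v) z₀ := by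
  have key := hasDerivAt_integral_of_dominated_loc_of_deriv_le (μ := volume) (𝕜 := ℂ)
    (F := fun (z : ℂ) (v : EuclideanSpace ℝ (Fin 3)) =>
      Complex.exp (((-2 * π * v 0 : ℝ) : ℂ) * z * Complex.I) * A v)
    (F' := fun (z : ℂ) (v : EuclideanSpace ℝ (Fin 3)) =>
      Complex.exp (((-2 * π * v 0 : ℝ) : ℂ) * z * Complex.I) *
        (((-2 * π * v 0 : ℝ) : ℂ) * Complex.I) * A v)
    (x₀ := z₀) (s := Metric.ball z₀ 1)
    (bound := fun v => 2 * π * max L 1 * Real.exp (2 * π * max L 1 * (‖z₀‖ + 1)) * ‖A v‖)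
    (Metric.ball_mem_nhds z₀ one_pos) ?_ ?_ ?_ ?_ ?_ ?_
  · exact key.2
  · exact Filter.Eventually.of_forall fun z => aestronglyMeasurable_integrand hA z
  · exact integrable_integrand hA hsupp z₀
  · exact aestronglyMeasurable_integrand_deriv hA z₀
  · refine ae_of_all _ fun v z hz => (norm_integrand_deriv_le hsupp z v).trans ?_
    have hz' : ‖z‖ ≤ ‖z₀‖ + 1 := by
      rw [Metric.mem_ball, dist_eq_norm] at hz
      calc ‖z‖ = ‖(z - z₀) + z₀‖ := by rw [sub_add_cancel]
        _ ≤ ‖z - z₀‖ + ‖z₀‖ := norm_add_le _ _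
        _ ≤ ‖z₀‖ + 1 := by linarith
    gcongr
  · exact hA.norm.const_mul _
  · refine ae_of_all _ fun v z _ => ?_
    have h := ((((hasDerivAt_id' z).const_mul ((-2 * π * v 0 : ℝ) : ℂ)).mul_const
      Complex.I).cexp).mul_const (A v)
    simpa only [mul_one] using h

/-- **Stub S1 (the slice is entire of exponential type).**  For an integrable `A : ℝ³ → ℂ`
vanishing outside the ball of radius `L`, the slice `s ↦ 𝓕 A (s e₀)` of its Fourier transform
along the first axis `e₀ = EuclideanSpace.single 0 1` extends to an entire function `Φ` of
exponential type: `Φ z = ∫ A v e^{-2π i z v₀} dv`, `‖Φ z‖ ≤ ‖A‖₁ e^{2π (max L 1) ‖z‖}`, and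
`Φ s = 𝓕 A (s • e₀)` for real `s` since `⟪v, s • e₀⟫ = s v₀`. [folklore] -/
theorem stub_sliceEntire : ∀ (A : EuclideanSpace ℝ (Fin 3) → ℂ) (L : ℝ), MeasureTheory.Integrable A →
    (∀ v : EuclideanSpace ℝ (Fin 3), L < ‖v‖ → A v = 0) →
    ∃ Φ : ℂ → ℂ, Differentiable ℂ Φ ∧
      (∃ B τ : ℝ, ∀ z : ℂ, ‖Φ z‖ ≤ B * Real.exp (τ * ‖z‖)) ∧
      ∀ s : ℝ, Φ (s : ℂ) = 𝓕 A (s • EuclideanSpace.single (0 : Fin 3) (1 : ℝ)) := by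
  intro A L hA hsupp
  refine ⟨fun z : ℂ => ∫ v : EuclideanSpace ℝ (Fin 3),
      Complex.exp (((-2 * π * v 0 : ℝ) : ℂ) * z * Complex.I) * A v, ?_, ?_, ?_⟩
  · -- entire: differentiate under the integral sign at every point
    exact fun z => (hasDerivAt_sliceIntegral hA hsupp z).differentiableAt
  · -- exponential type `‖Φ z‖ ≤ ‖A‖₁ e^{2π L' ‖z‖}`
    refine ⟨∫ v, ‖A v‖, 2 * π * max L 1, fun z => ?_⟩
    calc ‖∫ v : EuclideanSpace ℝ (Fin 3),
            Complex.exp (((-2 * π * v 0 : ℝ) : ℂ) * z * Complex.I) * A v‖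
        ≤ ∫ v : EuclideanSpace ℝ (Fin 3),
            ‖Complex.exp (((-2 * π * v 0 : ℝ) : ℂ) * z * Complex.I) * A v‖ :=
          norm_integral_le_integral_norm _
      _ ≤ ∫ v : EuclideanSpace ℝ (Fin 3), Real.exp (2 * π * max L 1 * ‖z‖) * ‖A v‖ :=
          integral_mono (integrable_integrand hA hsupp z).norm (hA.norm.const_mul _)
            fun v => norm_integrand_le hsupp z v
      _ = (∫ v, ‖A v‖) * Real.exp (2 * π * max L 1 * ‖z‖) := by
          rw [integral_const_mul, mul_comm]
  · -- real restriction: `⟪v, s • e₀⟫ = s v₀`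
    intro s
    rw [Real.fourier_eq']
    refine integral_congr_ae (ae_of_all _ fun v => ?_)
    have hinner : ⟪v, s • EuclideanSpace.single (0 : Fin 3) (1 : ℝ)⟫ = s * v 0 := by
      rw [real_inner_smul_right, EuclideanSpace.inner_single_right]
      simp
    have hexp : ((-2 * π * v 0 : ℝ) : ℂ) * (s : ℂ) * Complex.I =
        ((-2 * π * ⟪v, s • EuclideanSpace.single (0 : Fin 3) (1 : ℝ)⟫ : ℝ) : ℂ) * Complex.I := by
      rw [hinner]
      push_cast
      ring
    simp only [smul_eq_mul, hexp]

end Summit.AtomisticToContinuum.Crystallization.Theorems.ThreeConeCertificateExactCertificate.Invisibility
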